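import Literature.Probability.Percolation.AnnulusAlternation
import HarnessLib

/-!
# Frontier chains in thin annuli: `AnnulusAlternation` for `n < N`

Topic `Literature/Probability/Percolation`; family `crit-perc` / site percolation on `𝕋`.
`AnnulusAlternation.lean` extracts, from two open crossings `B₁ : s₁ ⇝ t₁`, `B₂ : s₂ ⇝ t₂` of the
hexagonal annulus `A = {n ≤ |·| ≤ N}` lying in distinct open clusters of `A`, the two closed
*frontier chains* of the cluster of `B₁` facing `B₂` (Kesten 1982, §2.3), their certified cyclic
order on `∂Λ_N` and their separation by the open arms (Bollobás–Riordan 2006, Ch. 7 Lemma 5), under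
the thickness hypothesis `n + 2 ≤ N`. That hypothesis enters at exactly one place,
`not_hole_then_out` ("a hole-dart and an outside-dart of the boundary cycle of the component are
never consecutive"), where it was proved from "consecutive tails are equal or adjacent". In fact
the boundary traversal keeps the TAIL at every change of head type (`fst_succ_eq_or_snd_succ_eq`),
so a hole-dart followed by an outside-dart would have a common tail of norm `n = N`; hence
`n < N` suffices (`not_hole_then_out_of_lt`). This file records the four structure theorems under
the sharp hypothesis `1 ≤ n < N` — the case `N = n + 1` (an annulus of two rings) is the collar
`Λ_{2s} ∖ Λ_s` at `s = 2` of the neck-tomography dictionary: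

* `nonempty_frontierChains_of_lt`, `annFrontier_order_of_lt`, `annFrontier_not_joined_of_lt`,
  `exists_frontierChains_alternating_of_lt`.

The proofs are those of `AnnulusAlternation.lean` verbatim (same vocabulary `annCluster`,
`annComp`, `annFrontier`, `FrontierChains`; the originals keep their signatures, so none of their
dependents is touched), with `not_hole_then_out_of_lt` in place of `not_hole_then_out`.
Everything here is proved; no named facts are introduced.

## References

* H. Kesten, *Percolation theory for mathematicians* (1982), §2.2–2.3. [KestenPTM1982]
* B. Bollobás, O. Riordan, *Percolation*, CUP (2006), Ch. 7 §7.2.2, Lemma 5 p. 169. [BollobasRiordan2006]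
* P. Nolin, *Near-critical percolation in two dimensions*, EJP 13 (2008), §4.1. [Nolin2008]

Tree: `AnnulusAlternation.lean` (definitions, dart bookkeeping), `TriBallDisc.lean` (`hexShift`,
`triBall_not_interleaved_shift`), `TriDiscShelling.lean` (`IsTriDisc`), `SitePaths.lean` (`PathIn`).
-/

noncomputable section

open Finset

namespace Literature.Probability.Percolation

open LatticeModels

variable {n N : ℕ} {ω : SiteConfig (Site 2)} {s₁ s₂ : Site 2}

/-- **A hole-dart and an outside-dart are never consecutive, for `n < N`**: at a change of head
type the boundary traversal keeps the tail, whose norm would be both `n` and `N`. [folklore] -/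
theorem not_hole_then_out_of_lt (hnN : n < N) {d : Site 2 × Site 2} (hd : d ∈ triBdryDarts (annCompFin n N ω s₁ s₂)) :
    ¬ ((triNorm d.2 < n ∧ (N : ℤ) < triNorm (triBdrySucc (annCompFin n N ω s₁ s₂) d).2) ∨
       ((N : ℤ) < triNorm d.2 ∧ triNorm (triBdrySucc (annCompFin n N ω s₁ s₂) d).2 < n)) := by
  have hd' := triBdrySucc_mem hd
  rintro (⟨h1, h2⟩ | ⟨h1, h2⟩)
  · rcases fst_succ_eq_or_snd_succ_eq (annCompFin n N ω s₁ s₂) d with e | e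
    · have e1 := norm_of_hole_dart hd h1
      have e2 := norm_of_out_dart hd' h2
      rw [e] at e2; omega
    · rw [e] at h2; omega
  · rcases fst_succ_eq_or_snd_succ_eq (annCompFin n N ω s₁ s₂) d with e | e
    · have e1 := norm_of_out_dart hd h1
      have e2 := norm_of_hole_dart hd' h2
      rw [e] at e2; omega
    · rw [e] at h2; omega

/-- **Existence of the frontier chains in a thin annulus** (`1 ≤ n < N`): as
`nonempty_frontierChains`, traversing the boundary cycle of the disc `U` (the component of `s₂` in
`A ∖ Cl`) from the dart `s₂ →` hole; the two maximal runs of cluster-darts adjacent to the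
hole/outside stretches around `t₂` have closed tails forming the two chains. [cite: KestenPTM1982, §2.3] -/
theorem nonempty_frontierChains_of_lt (hn : 1 ≤ n) (hnN : n < N) (hs₁ : triNorm s₁ = n) (hs₁ω : s₁ ∈ ω)
    {t₁ : Site 2} (ht₁ : t₁ ∈ annCluster n N ω s₁) (ht₁N : triNorm t₁ = N)
    (hs₂ : s₂ ∈ annComp n N ω s₁ s₂) (hs₂n : triNorm s₂ = n)
    {t₂ : Site 2} (ht₂ : t₂ ∈ annComp n N ω s₁ s₂) (ht₂N : triNorm t₂ = N) :
    Nonempty (FrontierChains n N ω s₁ s₂) := by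
  classical
  set G := annCompFin n N ω s₁ s₂ with hG
  set Cl := annCluster n N ω s₁ with hCl
  -- the disc and its base dart `s₂ → hole`
  obtain ⟨b, hb⟩ := exists_isTriDisc_annComp hn (by omega) hs₁ hs₁ω ht₁ ht₁N hs₂
  obtain ⟨h₂, hadj₂, hh₂⟩ := exists_adj_mem_triBall_sub_one hn hs₂n
  have hh₂' : triNorm h₂ < n := by
    have := hh₂; push_cast [Nat.cast_sub hn] at this; omega
  have hh₂G : h₂ ∉ G := fun h' => by
    have := (mem_triAnn.1 (annComp_subset (mem_annCompFin.1 h')).1).1; omega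
  have hds : (s₂, h₂) ∈ triBdryDarts G := mem_triBdryDarts.2 ⟨mem_annCompFin.2 hs₂, hh₂G, hadj₂⟩
  have h := hb.rebase hds
  set P := #(triBdryDarts G) with hP
  set it : ℕ → Site 2 × Site 2 := fun k => triBdryIter G (s₂, h₂) k with hit
  have it_mem : ∀ k, it k ∈ triBdryDarts G := fun k => triBdryIter_mem hds k
  have it_succ : ∀ k, it (k + 1) = triBdrySucc G (it k) := fun k => triBdryIter_succ G _ k
  -- types
  set Hole : ℕ → Prop := fun k => triNorm (it k).2 < n with hHole
  set Out : ℕ → Prop := fun k => (N : ℤ) < triNorm (it k).2 with hOut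
  set ClD : ℕ → Prop := fun k => (it k).2 ∈ Cl with hClD
  have cases3 : ∀ k, Hole k ∨ Out k ∨ ClD k := fun k => head_cases (it_mem k)
  have Cl_norm : ∀ v ∈ Cl, (n : ℤ) ≤ triNorm v ∧ triNorm v ≤ N := fun v hv =>
    mem_triAnn.1 (annCluster_subset hv).1
  have hole_not_out : ∀ k, Hole k → ¬ Out k := fun k h1 h2 => by
    simp only [hHole, hOut] at h1 h2; omega
  have hole_not_cl : ∀ k, Hole k → ¬ ClD k := fun k h1 h2 => by
    have := (Cl_norm _ h2).1; simp only [hHole] at h1; omega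
  have out_not_cl : ∀ k, Out k → ¬ ClD k := fun k h1 h2 => by
    have := (Cl_norm _ h2).2; simp only [hOut] at h1; omega
  have clD_of : ∀ k, ¬ Hole k → ¬ Out k → ClD k := fun k h1 h2 => by
    rcases cases3 k with h | h | h
    · exact absurd h h1
    · exact absurd h h2
    · exact h
  -- no hole/outside consecutive
  have no_HO : ∀ k, ¬ (Hole k ∧ Out (k + 1)) := fun k hk => by
    have := not_hole_then_out_of_lt hnN (it_mem k)
    rw [← it_succ] at this
    exact this (Or.inl hk)
  have no_OH : ∀ k, ¬ (Out k ∧ Hole (k + 1)) := fun k hk => by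
    have := not_hole_then_out_of_lt hnN (it_mem k)
    rw [← it_succ] at this
    exact this (Or.inr hk)
  -- at a type change the tail is kept: if the head is kept the type is kept
  have head_kept_or_tail_kept : ∀ k, (it (k + 1)).1 = (it k).1 ∨ (it (k + 1)).2 = (it k).2 := fun k => by
    rw [it_succ]; exact fst_succ_eq_or_snd_succ_eq G (it k)
  -- the hole-dart at position `0` and `P`
  have Hole0 : Hole 0 := by show triNorm (triBdryIter G (s₂, h₂) 0).2 < n; rw [triBdryIter_zero]; exact hh₂'
  have HoleP : Hole P := by show triNorm (triBdryIter G (s₂, h₂) P).2 < n; rw [h.cycle_len]; exact hh₂'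
  -- the outside-dart at `t₂`
  obtain ⟨o, hadjo, ho⟩ := exists_adj_triNorm_eq_add_one t₂
  have hoG : o ∉ G := fun h' => by
    have := (mem_triAnn.1 (annComp_subset (mem_annCompFin.1 h')).1).2; omega
  have hdt : (t₂, o) ∈ triBdryDarts G := mem_triBdryDarts.2 ⟨mem_annCompFin.2 ht₂, hoG, hadjo⟩
  obtain ⟨pt, hpt, hptd⟩ := h.cycle _ hdt
  have Out_pt : Out pt := by
    show (N : ℤ) < triNorm (triBdryIter G (s₂, h₂) pt).2; rw [hptd]; show (N : ℤ) < triNorm o; omega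
  -- FIRST CHAIN: `p_h` = last hole-dart `≤ pt`, `p_r` = first outside-dart after `p_h`
  set ph := Nat.findGreatest Hole pt with hph
  have Hole_ph : Hole ph := Nat.findGreatest_spec (P := Hole) (Nat.zero_le pt) Hole0
  have ph_le : ph ≤ pt := Nat.findGreatest_le pt
  have ph_max : ∀ k, ph < k → k ≤ pt → ¬ Hole k := fun k hk hk' => Nat.findGreatest_is_greatest hk hk'
  have ph_lt : ph < pt := lt_of_le_of_ne ph_le fun e => hole_not_out _ Hole_ph (e ▸ Out_pt)
  have hex_r : ∃ k, ph < k ∧ Out k := ⟨pt, ph_lt, Out_pt⟩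
  set pr := Nat.find hex_r with hpr
  obtain ⟨ph_lt_pr, Out_pr⟩ := Nat.find_spec hex_r
  have pr_min : ∀ k, ph < k → k < pr → ¬ Out k := fun k hk hk' hO => Nat.find_min hex_r hk' ⟨hk, hO⟩
  have pr_le : pr ≤ pt := Nat.find_min' hex_r ⟨ph_lt, Out_pt⟩
  have run1 : ∀ k, ph < k → k < pr → ClD k := fun k hk hk' =>
    clD_of k (ph_max k hk (by omega)) (pr_min k hk hk')
  have ph1_lt_pr : ph + 1 < pr := by
    rcases Nat.lt_or_ge (ph + 1) pr with hlt | hge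
    · exact hlt
    · exfalso
      have : pr = ph + 1 := by omega
      exact no_HO ph ⟨Hole_ph, this ▸ Out_pr⟩
  -- tails at the two ends
  have tail_ph1 : (it (ph + 1)).1 = (it ph).1 := by
    rcases head_kept_or_tail_kept ph with e | e
    · exact e
    · exfalso
      have : Hole (ph + 1) := by show triNorm (it (ph + 1)).2 < n; rw [e]; exact Hole_ph
      exact ph_max (ph + 1) (by omega) (by omega) this
  have tail_pr : (it pr).1 = (it (pr - 1)).1 := by
    have e0 : pr - 1 + 1 = pr := by omega
    rcases head_kept_or_tail_kept (pr - 1) with e | e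
    · rw [e0] at e; exact e
    · exfalso
      rw [e0] at e
      have : Out (pr - 1) := by show (N : ℤ) < triNorm (it (pr - 1)).2; rw [← e]; exact Out_pr
      exact pr_min (pr - 1) (by omega) (by omega) this
  -- the chain
  have chain1 : ∀ k, ph + 1 ≤ k → k < pr → PathIn triGraph (annFrontier n N ω s₁ s₂) (it (ph + 1)).1 (it k).1 := by
    intro k hk hk'
    induction k, hk using Nat.le_induction with
    | base => exact PathIn.refl (fst_mem_annFrontier (it_mem _) (run1 _ (by omega) hk'))
    | succ k hk ih =>
      have ih' := ih (by omega)
      have hmem : (it (k + 1)).1 ∈ annFrontier n N ω s₁ s₂ := fst_mem_annFrontier (it_mem _) (run1 _ (by omega) hk')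
      rcases fst_triBdrySucc_eq_or_adj G (mem_triBdryDarts.1 (it_mem k)).2.2 with e | hadj
      · rw [← it_succ] at e; rw [e] at hmem ⊢; exact ih'
      · rw [← it_succ] at hadj; exact ih'.tail hadj hmem
  -- transition data at `pr`: `it pr = (τ₁, apex)` with `it (pr-1) = (τ₁, c₁)`
  have trans1 : it pr = ((it (pr - 1)).1, triLeftApex (it (pr - 1)).1 (it (pr - 1)).2) := by
    have e0 : pr - 1 + 1 = pr := by omega
    have hsucc : it pr = triBdrySucc G (it (pr - 1)) := by rw [← it_succ, e0]
    rcases triBdrySucc_eq_or G (it (pr - 1)) with e | e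
    · rw [hsucc, e]
    · exfalso
      have hh : (it pr).2 = (it (pr - 1)).2 := by rw [hsucc, e]
      have : Out (pr - 1) := by show (N : ℤ) < triNorm (it (pr - 1)).2; rw [← hh]; exact Out_pr
      exact pr_min (pr - 1) (by omega) (by omega) this
  -- SECOND CHAIN: `ph'` = first hole-dart after `pt`, `pr'` = last outside-dart before `ph'`
  have hex_h : ∃ k, pt < k ∧ Hole k := ⟨P, hpt, HoleP⟩
  set ph' := Nat.find hex_h with hph'
  obtain ⟨pt_lt_ph', Hole_ph'⟩ := Nat.find_spec hex_h
  have ph'_min : ∀ k, pt < k → k < ph' → ¬ Hole k := fun k hk hk' hH => Nat.find_min hex_h hk' ⟨hk, hH⟩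
  set pr' := Nat.findGreatest Out (ph' - 1) with hpr'
  have Out_pr' : Out pr' := Nat.findGreatest_spec (P := Out) (show pt ≤ ph' - 1 by omega) Out_pt
  have pr'_le : pr' ≤ ph' - 1 := Nat.findGreatest_le (ph' - 1)
  have pt_le_pr' : pt ≤ pr' := Nat.le_findGreatest (show pt ≤ ph' - 1 by omega) Out_pt
  have pr'_max : ∀ k, pr' < k → k ≤ ph' - 1 → ¬ Out k := fun k hk hk' => Nat.findGreatest_is_greatest hk hk'
  have run2 : ∀ k, pr' < k → k < ph' → ClD k := fun k hk hk' =>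
    clD_of k (ph'_min k (by omega) hk') (pr'_max k hk (by omega))
  have pr'1_lt : pr' + 1 < ph' := by
    rcases Nat.lt_or_ge (pr' + 1) ph' with hlt | hge
    · exact hlt
    · exfalso
      have : ph' = pr' + 1 := by omega
      exact no_OH pr' ⟨Out_pr', this ▸ Hole_ph'⟩
  have tail_pr'1 : (it (pr' + 1)).1 = (it pr').1 := by
    rcases head_kept_or_tail_kept pr' with e | e
    · exact e
    · exfalso
      have : Out (pr' + 1) := by show (N : ℤ) < triNorm (it (pr' + 1)).2; rw [e]; exact Out_pr'
      exact pr'_max (pr' + 1) (by omega) (by omega) this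
  have tail_ph' : (it ph').1 = (it (ph' - 1)).1 := by
    have e0 : ph' - 1 + 1 = ph' := by omega
    rcases head_kept_or_tail_kept (ph' - 1) with e | e
    · rw [e0] at e; exact e
    · exfalso
      rw [e0] at e
      have : Hole (ph' - 1) := by show triNorm (it (ph' - 1)).2 < n; rw [← e]; exact Hole_ph'
      exact ph'_min (ph' - 1) (by omega) (by omega) this
  have chain2 : ∀ k, pr' + 1 ≤ k → k < ph' → PathIn triGraph (annFrontier n N ω s₁ s₂) (it (pr' + 1)).1 (it k).1 := by
    intro k hk hk'
    induction k, hk using Nat.le_induction with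
    | base => exact PathIn.refl (fst_mem_annFrontier (it_mem _) (run2 _ (by omega) hk'))
    | succ k hk ih =>
      have ih' := ih (by omega)
      have hmem : (it (k + 1)).1 ∈ annFrontier n N ω s₁ s₂ := fst_mem_annFrontier (it_mem _) (run2 _ (by omega) hk')
      rcases fst_triBdrySucc_eq_or_adj G (mem_triBdryDarts.1 (it_mem k)).2.2 with e | hadj
      · rw [← it_succ] at e; rw [e] at hmem ⊢; exact ih'
      · rw [← it_succ] at hadj; exact ih'.tail hadj hmem
  -- transition data at `pr'`: `it (pr'+1) = (τ₂, apex (τ₂, o₂))`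
  have trans2 : it (pr' + 1) = ((it pr').1, triLeftApex (it pr').1 (it pr').2) := by
    rcases triBdrySucc_eq_or G (it pr') with e | e
    · rw [it_succ, e]
    · exfalso
      have hh : (it (pr' + 1)).2 = (it pr').2 := by rw [it_succ, e]
      have : Out (pr' + 1) := by show (N : ℤ) < triNorm (it (pr' + 1)).2; rw [hh]; exact Out_pr'
      exact pr'_max (pr' + 1) (by omega) (by omega) this
  -- assemble
  have ClD_pr1 : ClD (pr - 1) := run1 (pr - 1) (by omega) (by omega)
  have ClD_pr'1 : ClD (pr' + 1) := run2 (pr' + 1) (by omega) pr'1_lt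
  obtain ⟨-, -, hadj_pr1⟩ := tail_of_cluster_dart (it_mem (pr - 1)) ClD_pr1
  obtain ⟨-, hout_pr', hadj_pr'⟩ := mem_triBdryDarts.1 (it_mem pr')
  refine ⟨{
    σ₁ := (it ph).1
    τ₁ := (it (pr - 1)).1
    c₁ := (it (pr - 1)).2
    τ₂ := (it pr').1
    σ₂ := (it ph').1
    o₂ := (it pr').2
    chain₁ := ?_
    chain₂ := ?_
    norm_σ₁ := norm_of_hole_dart (it_mem ph) Hole_ph
    norm_τ₁ := ?_
    norm_τ₂ := norm_of_out_dart (it_mem pr') Out_pr'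
    norm_σ₂ := norm_of_hole_dart (it_mem ph') Hole_ph'
    c₁_mem := ClD_pr1
    adj₁ := hadj_pr1
    apex₁_out := ?_
    o₂_out := Out_pr'
    adj₂ := hadj_pr'
    apex₂_mem := ?_ }⟩
  · -- chain₁
    have := chain1 (pr - 1) (by omega) (by omega)
    rw [tail_ph1] at this
    exact this
  · -- chain₂
    have := chain2 (ph' - 1) (by omega) (by omega)
    rw [tail_pr'1, ← tail_ph'] at this
    exact this
  · -- norm of `τ₁`
    rw [← tail_pr]; exact norm_of_out_dart (it_mem pr) Out_pr
  · -- the apex of `τ₁ → c₁` is the head of the outside-dart `it pr`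
    have : (it pr).2 = triLeftApex (it (pr - 1)).1 (it (pr - 1)).2 := by rw [trans1]
    rw [← this]; exact Out_pr
  · -- the apex of `τ₂ → o₂` is the head of the cluster-dart `it (pr'+1)`
    have : (it (pr' + 1)).2 = triLeftApex (it pr').1 (it pr').2 := by rw [trans2]
    rw [← this]; exact ClD_pr'1

/-- **The cyclic order on `∂Λ_N` read from `τ₁`, thin annulus** (`1 ≤ n < N`): in the perimeter
coordinate shifted to `τ₁`, every site of the component precedes every site of the cluster, every
component site is `≤ τ₂`, `τ₂ <` every cluster site, and every open component site `t` has
`0 < t < τ₂` (as `annFrontier_order`, by `triBall_not_interleaved_shift`). [cite: BollobasRiordan2006, Ch. 7 Lemma 5 p. 169] -/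
theorem annFrontier_order_of_lt (hn : 1 ≤ n) (hnN : n < N) (F : FrontierChains n N ω s₁ s₂) :
    (∀ u ∈ annComp n N ω s₁ s₂, ∀ c ∈ annCluster n N ω s₁, triNorm u = N → triNorm c = N →
        hexShift N F.τ₁ u < hexShift N F.τ₁ c) ∧
      (∀ u ∈ annComp n N ω s₁ s₂, triNorm u = N → hexShift N F.τ₁ u ≤ hexShift N F.τ₁ F.τ₂) ∧
      (∀ c ∈ annCluster n N ω s₁, triNorm c = N → hexShift N F.τ₁ F.τ₂ < hexShift N F.τ₁ c) ∧
      (∀ t ∈ annComp n N ω s₁ s₂, t ∈ ω → triNorm t = N →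
        0 < hexShift N F.τ₁ t ∧ hexShift N F.τ₁ t < hexShift N F.τ₁ F.τ₂) := by
  have hN : 1 ≤ N := by omega
  set U := annComp n N ω s₁ s₂ with hU
  set Cl := annCluster n N ω s₁ with hCl
  have hτ₁U : F.τ₁ ∈ U := annFrontier_subset_annComp F.chain₁.right_mem
  have hτ₂U : F.τ₂ ∈ U := annFrontier_subset_annComp F.chain₂.left_mem
  have hτ₁c : F.τ₁ ∉ ω := (F.chain₁.right_mem).2.1
  have hτ₂c : F.τ₂ ∉ ω := (F.chain₂.left_mem).2.1
  have disj : ∀ v ∈ U, v ∉ Cl := fun v hv => (annComp_subset hv).2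
  -- the clockwise neighbour `c₁`
  have hc₁N : triNorm F.c₁ = N := by
    have h1 := (mem_triAnn.1 (annCluster_subset F.c₁_mem).1).2
    have h2 := triNorm_le_triNorm_add_one_of_adj (triGraph_adj_triLeftApex_right F.adj₁).symm
    have h3 := F.apex₁_out
    omega
  have hc₁out : triLeftApex F.τ₁ F.c₁ ∉ triBall N := by rw [mem_triBall_iff, not_le]; exact F.apex₁_out
  have hsh_c₁ : hexShift N F.τ₁ F.c₁ = 6 * N - 1 :=
    hexShift_eq_last hN F.norm_τ₁ hc₁N (hexPos_of_leftApex_out hN F.norm_τ₁ hc₁N F.adj₁ hc₁out)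
  -- (i)
  have hI : ∀ u ∈ U, ∀ c ∈ Cl, triNorm u = N → triNorm c = N → hexShift N F.τ₁ u < hexShift N F.τ₁ c := by
    intro u hu c hc huN hcN
    by_contra hle
    rw [not_lt] at hle
    have hne : hexShift N F.τ₁ c ≠ hexShift N F.τ₁ u := fun e =>
      disj u hu ((hexShift_injOn hN hcN huN e) ▸ hc)
    have hlt : hexShift N F.τ₁ c < hexShift N F.τ₁ u := lt_of_le_of_ne hle hne
    have h0 : 0 < hexShift N F.τ₁ c := by
      have hne' : hexShift N F.τ₁ c ≠ hexShift N F.τ₁ F.τ₁ := fun e =>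
        disj _ hτ₁U ((hexShift_injOn hN hcN F.norm_τ₁ e) ▸ hc)
      rw [hexShift_self] at hne'
      exact lt_of_le_of_ne (hexShift_range hN F.norm_τ₁ hcN).1 hne'.symm
    have h1 : hexShift N F.τ₁ u < hexShift N F.τ₁ F.c₁ := by
      have hne' : hexShift N F.τ₁ u ≠ hexShift N F.τ₁ F.c₁ := fun e =>
        disj u hu ((hexShift_injOn hN huN hc₁N e).symm ▸ F.c₁_mem)
      have := (hexShift_range hN F.norm_τ₁ huN).2
      rw [hsh_c₁]; omega
    refine triBall_not_interleaved_shift hN U F.norm_τ₁ F.norm_τ₁ hcN huN hc₁N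
      (by rw [hexShift_self]; exact h0) hlt h1 (pathIn_ball_inter_annComp hτ₁U hu) (pathIn_ball_diff_annComp hc F.c₁_mem)
  -- the anticlockwise neighbour `c₂ = apex (τ₂ → o₂)`
  have hc₂in : triLeftApex F.τ₂ F.o₂ ∈ triBall N :=
    mem_triBall_iff.2 (mem_triAnn.1 (annCluster_subset F.apex₂_mem).1).2
  obtain ⟨hc₂N, hc₂succ⟩ := hexPos_of_leftApex_in hN F.norm_τ₂ F.o₂_out F.adj₂ hc₂in
  have hsh_c₂ : hexShift N F.τ₁ (triLeftApex F.τ₂ F.o₂) = hexShift N F.τ₁ F.τ₂ + 1 :=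
    hexShift_eq_add_one hN F.norm_τ₁ F.norm_τ₂ hc₂N hc₂succ fun e => disj _ hτ₁U (e ▸ F.apex₂_mem)
  -- (ii)
  have hII : ∀ u ∈ U, triNorm u = N → hexShift N F.τ₁ u ≤ hexShift N F.τ₁ F.τ₂ := by
    intro u hu huN
    have := hI u hu _ F.apex₂_mem huN hc₂N
    rw [hsh_c₂] at this; omega
  refine ⟨hI, hII, fun c hc hcN => hI _ hτ₂U c hc F.norm_τ₂ hcN, fun t ht htω htN => ⟨?_, ?_⟩⟩
  · have hne : hexShift N F.τ₁ t ≠ hexShift N F.τ₁ F.τ₁ := fun e => hτ₁c ((hexShift_injOn hN htN F.norm_τ₁ e) ▸ htω)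
    rw [hexShift_self] at hne
    exact lt_of_le_of_ne (hexShift_range hN F.norm_τ₁ htN).1 hne.symm
  · have hne : hexShift N F.τ₁ t ≠ hexShift N F.τ₁ F.τ₂ := fun e => hτ₂c ((hexShift_injOn hN htN F.norm_τ₂ e) ▸ htω)
    exact lt_of_le_of_ne (hII t ht htN) hne

/-- **The two frontier chains are not joined by a closed path of a thin annulus** (as
`annFrontier_not_joined`: such a path against `t₂ ⇝ s₂ → hole ⇝ s₁ ⇝ t₁` would be interleaved in
`Λ_N`). [cite: BollobasRiordan2006, Ch. 7 Lemma 5 p. 169] -/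
theorem annFrontier_not_joined_of_lt (hn : 1 ≤ n) (hnN : n < N) {t₁ t₂ : Site 2}
    (hB₁ : PathIn triGraph (triAnn n N ∩ ω) s₁ t₁) (hs₁ : triNorm s₁ = n) (ht₁ : triNorm t₁ = N)
    (hB₂ : PathIn triGraph (triAnn n N ∩ ω) s₂ t₂) (hs₂ : triNorm s₂ = n) (ht₂ : triNorm t₂ = N)
    (hsep : ¬ PathIn triGraph (triAnn n N ∩ ω) s₁ s₂) (F : FrontierChains n N ω s₁ s₂) :
    ¬ PathIn triGraph (triAnn n N \ ω) F.τ₁ F.τ₂ := by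
  intro hπ
  have hN : 1 ≤ N := by omega
  obtain ⟨-, -, hIII, hIV⟩ := annFrontier_order_of_lt hn hnN F
  have ht₂U : t₂ ∈ annComp n N ω s₁ s₂ := mem_annComp_of_pathIn hsep hB₂
  have ht₁Cl : t₁ ∈ annCluster n N ω s₁ := hB₁
  obtain ⟨h0, h1⟩ := hIV t₂ ht₂U hB₂.right_mem.2 ht₂
  have h2 := hIII t₁ ht₁Cl ht₁
  -- the path of `(A ∖ ω)ᶜ`: `t₂ ⇝ s₂ → hole ⇝ s₁ ⇝ t₁`
  set B : Set (Site 2) := triAnn n N \ ω with hB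
  have openB : ∀ {a b : Site 2}, PathIn triGraph (triAnn n N ∩ ω) a b →
      PathIn triGraph ((↑(triBall N) : Set (Site 2)) ∩ Bᶜ) a b := fun hp =>
    hp.mono fun z hz => ⟨Finset.mem_coe.2 (mem_triBall_iff.2 (mem_triAnn.1 hz.1).2), fun h => h.2 hz.2⟩
  have holeB : ∀ z : Site 2, triNorm z < n → z ∈ (↑(triBall N) : Set (Site 2)) ∩ Bᶜ := fun z hz =>
    ⟨Finset.mem_coe.2 (mem_triBall_iff.2 (by omega)), fun h => by have := (mem_triAnn.1 h.1).1; omega⟩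
  obtain ⟨g₁, hadj₁, hg₁⟩ := exists_adj_mem_triBall_sub_one hn hs₁
  obtain ⟨g₂, hadj₂, hg₂⟩ := exists_adj_mem_triBall_sub_one hn hs₂
  have hg₁' : triNorm g₁ < n := by have := hg₁; push_cast [Nat.cast_sub hn] at this; omega
  have hg₂' : triNorm g₂ < n := by have := hg₂; push_cast [Nat.cast_sub hn] at this; omega
  have phole : PathIn triGraph ((↑(triBall N) : Set (Site 2)) ∩ Bᶜ) g₂ g₁ :=
    (pathIn_triBall hg₂ hg₁).mono fun z hz => holeB z (by
      have := mem_triBall_iff.1 (Finset.mem_coe.1 hz); push_cast [Nat.cast_sub hn] at this; omega)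
  have hQ : PathIn triGraph ((↑(triBall N) : Set (Site 2)) ∩ Bᶜ) t₂ t₁ :=
    ((((openB hB₂).symm.tail hadj₂ (holeB g₂ hg₂')).trans phole).trans
      (PathIn.of_adj (holeB g₁ hg₁') (openB hB₁).left_mem hadj₁.symm)).trans (openB hB₁)
  have hP : PathIn triGraph ((↑(triBall N) : Set (Site 2)) ∩ B) F.τ₁ F.τ₂ :=
    hπ.mono fun z hz => ⟨Finset.mem_coe.2 (mem_triBall_iff.2 (mem_triAnn.1 hz.1).2), hz⟩
  exact triBall_not_interleaved_shift hN B F.norm_τ₁ F.norm_τ₁ ht₂ F.norm_τ₂ ht₁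
    (by rw [hexShift_self]; exact h0) h1 h2 hP hQ

/-- **Two open crossings in distinct open clusters of a thin annulus yield a certified alternating
family** (`1 ≤ n < N`; as `exists_frontierChains_alternating`): frontier chains not joined by a
closed path of `A`, and anticlockwise from `τ₁`: `τ₁ < t₂ < τ₂ < t₁`. [cite: Nolin2008, §4.1 (arXiv 0711.4948)] [cite: BollobasRiordan2006, Ch. 7 Lemma 5 p. 169] -/
theorem exists_frontierChains_alternating_of_lt (hn : 1 ≤ n) (hnN : n < N) {t₁ t₂ : Site 2}
    (hB₁ : PathIn triGraph (triAnn n N ∩ ω) s₁ t₁) (hs₁ : triNorm s₁ = n) (ht₁ : triNorm t₁ = N)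
    (hB₂ : PathIn triGraph (triAnn n N ∩ ω) s₂ t₂) (hs₂ : triNorm s₂ = n) (ht₂ : triNorm t₂ = N)
    (hsep : ¬ PathIn triGraph (triAnn n N ∩ ω) s₁ s₂) :
    ∃ F : FrontierChains n N ω s₁ s₂,
      ¬ PathIn triGraph (triAnn n N \ ω) F.τ₁ F.τ₂ ∧
      0 < hexShift N F.τ₁ t₂ ∧ hexShift N F.τ₁ t₂ < hexShift N F.τ₁ F.τ₂ ∧
      hexShift N F.τ₁ F.τ₂ < hexShift N F.τ₁ t₁ := by
  have hs₂U : s₂ ∈ annComp n N ω s₁ s₂ := mem_annComp_of_pathIn hsep (PathIn.refl hB₂.left_mem)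
  have ht₂U : t₂ ∈ annComp n N ω s₁ s₂ := mem_annComp_of_pathIn hsep hB₂
  obtain ⟨F⟩ := nonempty_frontierChains_of_lt hn hnN hs₁ hB₁.left_mem.2 hB₁ ht₁ hs₂U hs₂ ht₂U ht₂
  obtain ⟨-, -, hIII, hIV⟩ := annFrontier_order_of_lt hn hnN F
  obtain ⟨h0, h1⟩ := hIV t₂ ht₂U hB₂.right_mem.2 ht₂
  exact ⟨F, annFrontier_not_joined_of_lt hn hnN hB₁ hs₁ ht₁ hB₂ hs₂ ht₂ hsep F, h0, h1, hIII t₁ hB₁ ht₁⟩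

end Literature.Probability.Percolation
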